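import Summits.BirchSwinnertonDyer.BirchSwinnertonDyer.Theorems.AdditiveKolyvaginRoadManinFrameResidueProperRTameTwistSplit
import Mathlib.FieldTheory.Finite.Basic
import HarnessLib

/-!
# Route `AdditiveKolyvaginRoad`, crux `ManinFrameResidueProperR` (stmt-BirchSwinnertonDyer-20709), line
# `tame-twist`, stub S57 (`p ∈ {5, 7}`): the residue `x_p` and fourth powers modulo `p` — `--supports`, helper

Cell `pub/bsd-wall`, seat `bsd-wall-manin-p1` g4. Two finite/elementary inputs of the `p ∈ {5, 7}` splitting
`…RTameTwistSplit57`: `residue57` (in `𝔽₅`, `𝔽₇`: the class `x₅ = 4`, `x₇ = 3` is `≠ 0, 1, d₀⁴` and `−x_p`,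
`−d₀⁴/x_p` are squares) and `pow_four_entry_eq_pow_four` (`(γ⁴)₁₁ ≡ (γ₁₁)⁴` modulo a prime dividing `(γ)₁₀`,
g3's `pow_four_entry_isSquare` with the fourth root exposed). Everything proved; no definition.
-/

set_option autoImplicit false
set_option linter.dupNamespace false

noncomputable section

open scoped MatrixGroups Classical

open CongruenceSubgroup Matrix

namespace Summit.BirchSwinnertonDyer.BirchSwinnertonDyer.Theorems.ManinFrameResidueProperRTameTwist

section Residue57

/-- **The residue `x_p` at `p ∈ {5, 7}`** (`x₅ = 4`, `x₇ = 3`): for every non-zero `d₀ ∈ 𝔽_p`, `x_p ≠ 0, 1,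
d₀⁴`, `−x_p` is a square and `−d₀⁴ = r²·x_p` for some `r` (so `−d₀⁴/x_p` is a square) in `𝔽_p` (a finite
check). [folklore] -/
theorem residue57 {p : ℕ} (hp57 : p = 5 ∨ p = 7) (d0 : ZMod p) (hd0 : d0 ≠ 0) :
    (((if p = 5 then 4 else 3 : ℕ) : ZMod p)) ≠ 0 ∧ (((if p = 5 then 4 else 3 : ℕ) : ZMod p)) ≠ 1 ∧
      (((if p = 5 then 4 else 3 : ℕ) : ZMod p)) ≠ d0 ^ 4 ∧
      (∃ r : ZMod p, -(((if p = 5 then 4 else 3 : ℕ) : ZMod p)) = r * r) ∧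
      (∃ r : ZMod p, -(d0 ^ 4) = r * r * (((if p = 5 then 4 else 3 : ℕ) : ZMod p))) := by
  rcases hp57 with rfl | rfl
  · simp only [if_true]
    revert d0
    decide
  · simp only [show (7 : ℕ) ≠ 5 by decide, if_false]
    revert d0
    decide

end Residue57

section PowFour57

/-- **`(γ⁴)₁₁ ≡ ((γ)₁₁)⁴` modulo a prime `ℓ ∣ (γ)₁₀`**: the lower-right entry of `γ⁴` is a non-zero FOURTH
POWER modulo `ℓ` (as `gcd(c, d) = 1`). Same computation as g3's `pow_four_entry_isSquare`, with the fourth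
root exposed. [folklore] -/
theorem pow_four_entry_eq_pow_four {N : ℕ} (γ : Gamma0 N) {ℓ : ℕ} (hℓ : ℓ.Prime)
    (hℓc : (ℓ : ℤ) ∣ (γ : SL(2, ℤ)) 1 0) :
    ∃ d0 : ZMod ℓ, d0 ≠ 0 ∧ ((((γ ^ 4 : Gamma0 N) : SL(2, ℤ)) 1 1 : ℤ) : ZMod ℓ) = d0 ^ 4 := by
  haveI : Fact ℓ.Prime := ⟨hℓ⟩
  set f := Int.castRingHom (ZMod ℓ) with hf
  set A : Matrix (Fin 2) (Fin 2) (ZMod ℓ) := f.mapMatrix ((γ : SL(2, ℤ)) : Matrix (Fin 2) (Fin 2) ℤ)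
    with hA
  have hcoe : ((γ ^ 4 : Gamma0 N) : SL(2, ℤ)) = (γ : SL(2, ℤ)) ^ 4 := rfl
  have hpow : A ^ 4 = f.mapMatrix (((γ : SL(2, ℤ)) ^ 4 : SL(2, ℤ)) : Matrix (Fin 2) (Fin 2) ℤ) := by
    rw [Matrix.SpecialLinearGroup.coe_pow, map_pow]
  have hentry : ((((γ ^ 4 : Gamma0 N) : SL(2, ℤ)) 1 1 : ℤ) : ZMod ℓ) = (A ^ 4) 1 1 := by
    rw [hcoe, hpow]; rfl
  have hc0 : A 1 0 = 0 := by
    show (((((γ : SL(2, ℤ)) 1 0 : ℤ)) : ZMod ℓ)) = 0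
    exact (ZMod.intCast_zmod_eq_zero_iff_dvd _ ℓ).mpr hℓc
  obtain ⟨a, b, c, d, hAeq⟩ : ∃ a b c d : ZMod ℓ, A = !![a, b; c, d] :=
    ⟨A 0 0, A 0 1, A 1 0, A 1 1, Matrix.eta_fin_two A⟩
  have hc : c = 0 := by
    have : A 1 0 = c := by rw [hAeq]; rfl
    rw [← this, hc0]
  have h44 : (A ^ 4) 1 1 = d ^ 4 := by
    rw [hAeq, hc, pow_succ, pow_succ, pow_succ, pow_one]
    simp only [Matrix.mul_fin_two, Matrix.of_apply, Matrix.cons_val', Matrix.cons_val_zero,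
      Matrix.cons_val_one]
    ring
  have hdet : A.det = 1 := by
    rw [hA, ← RingHom.map_det, (γ : SL(2, ℤ)).2, map_one]
  have hd0 : d ≠ 0 := by
    intro h0
    rw [hAeq, Matrix.det_fin_two_of, hc, h0] at hdet
    simp at hdet
  exact ⟨d, hd0, by rw [hentry, h44]⟩

end PowFour57

end Summit.BirchSwinnertonDyer.BirchSwinnertonDyer.Theorems.ManinFrameResidueProperRTameTwist

end
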